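import Summits.HodgeConjecture.HodgeConjecture.Theorems.SixfoldTableXCensusWeilGeneralRow
import Literature.AlgebraicGeometry.HodgeTheory.WeilTypeSixfoldHodgeGroupSUOfLie
import HarnessLib

/-!
# TABLE X (dimension 6) — row 9 `g6.Weil.k.(3,3)` with van Geemen's class `h_K`: L12's census verdict and its
# «HC ⟸ {Markman₆, R-W6}» corollaries RE-KEYED from `HasHodgeGroupSU A φ 3 d h_K` to the displayed LIE hypothesis `hSU`
# (cell `pub-hodgeav-hg6`, req-37 (A) Q2b; eng-3 g3, B5b deliverable 2; lead g3 2026-08-29T03:42:31Z)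

HONEST FRAMING. HC, `HC_AV` (stmt-1333), `HC_CM` (stmt-3052) and H2 are NOT proved and do not occur. X2 / X1 stay
`@[conjecture]` (OURS); R-W6, Markman₆ and `WeilSixfolds` appear only as displayed hypotheses; the Lie hypothesis `hSU` (brick
B4′'s conclusion, for every polarization `ψ` of `H¹(A(ℂ); ℚ)`; NOT yet a tree theorem) is DISPLAYED verbatim on every theorem
and never discharged. KERNEL ONLY: theorems over existing declarations; no definition, no `sorry`, no named fact; restates nothing.

WHY THIS MODULE. L12 (`SixfoldTableXCensusWeilGeneralRow`: `TableX.WeilRows.census_row9_generalWeil`, `…_of_isIsogenous`,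
`hodgeConjectureFor_generalWeilSixfold_of_weilSixfolds` / `_of_markman₆_nonsplit` / `hodgeConjectureFor_of_isIsogenous_…`)
displays van Geemen's GENERAL-MEMBER hypothesis `HasHodgeGroupSU A φ 3 d h_K` (`Hg|_{H¹} = SU_H(ℂ)` for the `K`-symmetrised
hyperplane class `h_K = d·e^*a + φ^*e^*a`). By B5a §6 (`IsWeilType.hasHodgeGroupSU_ksymm_of_hodgeLieC`,
`Literature/AlgebraicGeometry/HodgeTheory/WeilTypeSixfoldHodgeGroupSUOfLie`) that hypothesis follows, for EVERY Weil-type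
`(A, φ)` with `End⁰(A) = K` (`finrank_ℚ End⁰(A) = 2`), from the Lie hypothesis `hSU` alone. This file is the re-keying:
`HasHodgeGroupSU A φ 3 d h_K ↦ (IsWeilType A φ 3 d) + (finrank_ℚ End⁰(A) = 2) + hSU`. When S4 lands, `hSU` is discharged by
`fun ψ ↦ B4′ hW hE2 ψ` (B5c) and row 9 reads «ALL members with `End⁰ = K`», i.e. no special members; until then every
statement here is CONDITIONAL on the displayed `hSU`. Companion: `SixfoldTableXCensusWeilEndFieldRowsOfLie` (the `h`-general
W1G re-keying). All declarations in the sub-namespace `TableX.WeilLieRows`; typed ≠ proved.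
-/

set_option linter.dupNamespace false

noncomputable section

open scoped TensorProduct
open CategoryTheory
open Literature.AlgebraicGeometry Literature.AlgebraicGeometry.Motives
open Literature.AlgebraicGeometry.Motives.AbelianVariety (IsIsogenous IsSimple)
open Literature.AlgebraicGeometry.Motives.HodgeStructure
open Literature.AlgebraicGeometry.HodgeTheory
open Literature.AlgebraicGeometry.Milne1999
open Literature.AlgebraicGeometry.VanGeemen1994 (HasHodgeGroupSU hK)
open Literature.AlgebraicTopology.SingularHomology
open Literature.Barriers.HodgeConjecture
open Summit.HodgeConjecture.HodgeConjecture.Ring2.ClassTargets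
open Summit.HodgeConjecture.HodgeConjecture.Ring2.Motiv (ProdCMCell)
open Summit.HodgeConjecture.HodgeConjecture.Ring2.Atlas (IsQuarticFieldTypeIVFourfold)

namespace Summit.HodgeConjecture.HodgeConjecture.TableX.WeilLieRows

variable (A : AbelianVariety ℂ) (φ : A ⟶ A) (d : ℕ) (e : ProjectiveEmbedding A.X)
  (a : complexBetti (projectiveSpace e.n ℂ) 2)

/-! ## §1 Row 9 with `h_K`: the census verdict MODULO the Lie hypothesis -/

/-- **TABLE X ROW 9 `g6.Weil.k.(3,3)` (`End⁰ = K`, ALL MEMBERS MODULO `hSU`), KERNEL VERDICT WITH DOMAIN MEMBERSHIP** — L12's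
`TableX.WeilRows.census_row9_generalWeil` with `HasHodgeGroupSU A φ 3 d h_K` REPLACED by `(A, φ)` of Weil type `(3, d)`,
`finrank_ℚ End⁰(A) = 2` and the displayed Lie hypothesis `hSU` (via `IsWeilType.hasHodgeGroupSU_ksymm_of_hodgeLieC`): for a
projective embedding `e` and a rational class `a ≠ 0` on the ambient projective space, `(dim A = 6 ∧ ¬ 𝒞 A) ∧` X2-at-`A` `∧`
X1-at-`A`. HC NOT proved; `hSU` displayed, not discharged. [cite: vanGeemen1994HodgeAV, Thm. 6.11, Thm. 6.12 and 4.9]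
[cite: Deligne1982HodgeCycles, I §3 Prop. 3.4 and 3.6] [cite: MoonenZarhin1999LowDim, Thm. 0.2 and §5 (5.1)] -/
theorem census_row9_ksymm_ofLie (hW : IsWeilType A φ 3 d) (hE2 : Module.finrank ℚ A.endAlgebra = 2)
    (hSU : haveI : HodgeTensorFacts.{0, 0} := hodgeTensorFacts_holds
      ∀ (ψ : (BettiUniverse.hodge exists_isReal_hodgeModel_holds (AbelianVariety.isSmoothProjective_holds (A := A)) 1).Polarization)
        (Y : Module.End ℂ (ℂ ⊗[ℚ] bettiCohomology A.X 1))
        (hYφ : Y * ((bettiCohomology.map φ.hom.hom.hom 1).hom).baseChange ℂ =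
          ((bettiCohomology.map φ.hom.hom.hom 1).hom).baseChange ℂ * Y),
        (∀ x y, ψ.form.baseChange ℂ (Y x) y + ψ.form.baseChange ℂ x (Y y) = 0) →
        LinearMap.trace ℂ _ (Y.restrict fun x (hx : x ∈ Module.End.eigenspace
            (((bettiCohomology.map φ.hom.hom.hom 1).hom).baseChange ℂ) (Complex.I * (Real.sqrt d : ℂ))) =>
          UnitaryTheta.apply_mem_eigenspace_of_commute hYφ hx) = 0 →
        Y ∈ (BettiUniverse.hodge exists_isReal_hodgeModel_holds (AbelianVariety.isSmoothProjective_holds (A := A)) 1).hodgeLieC)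
    (ha : IsRationalClass a) (ha0 : a ≠ 0) :
    (A.dim = 6 ∧ ¬ (IsOfCMType A ∨ ProdCMCell IsQuarticFieldTypeIVFourfold (fun Z ↦ Z.dim = 2) A)) ∧
    (∀ c : complexBetti A.X (2 * 2), IsRationalClass c → IsOfHodgeType A.dim A.X (2 * 2) 2 2 c →
      c ∈ divisorClassesSpan A.X A.dim 2 ⊔ Submodule.span ℂ {w' : complexBetti A.X (2 * 2) |
        ∃ (C : AbelianVariety ℂ) (g : A.X ⟶ C.X) (w : complexBetti C.X (2 * 2)), C.dim < A.dim ∧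
          IsRationalClass w ∧ IsOfHodgeType C.dim C.X (2 * 2) 2 2 w ∧ w' = complexBetti.map g (2 * 2) w}) ∧
    (∀ c : complexBetti A.X (2 * 3), IsRationalClass c → IsOfHodgeType A.dim A.X (2 * 3) 3 3 c →
      c ∈ divisorClassesSpan A.X A.dim 3 ⊔ Submodule.span ℂ {w' : complexBetti A.X (2 * 3) |
          ∃ (a : complexBetti A.X (2 * 2)) (b : complexBetti A.X (2 * 1)),
            IsRationalClass a ∧ IsOfHodgeType A.dim A.X (2 * 2) 2 2 a ∧ IsRationalClass b ∧
            IsOfHodgeType A.dim A.X (2 * 1) 1 1 b ∧ w' = cupProduct (two_mul_add_two_mul 2 1) a b} ⊔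
        Submodule.span ℂ {w' : complexBetti A.X (2 * 3) |
          ∃ (C : AbelianVariety ℂ) (g : A.X ⟶ C.X) (w : complexBetti C.X (2 * 3)), C.dim < A.dim ∧
            IsRationalClass w ∧ IsOfHodgeType C.dim C.X (2 * 3) 3 3 w ∧ w' = complexBetti.map g (2 * 3) w} ⊔
        Submodule.span ℂ {w' : complexBetti A.X (2 * 3) |
          ∃ (B' : AbelianVariety ℂ) (g : A.X ⟶ B'.X) (d : ℕ) (ψ : B' ⟶ B') (w : complexBetti B'.X (2 * 3)),
            B'.dim = 6 ∧ 0 < d ∧ ψ ≫ ψ = -(d • 𝟙 B') ∧ IsRationalClass w ∧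
            IsOfHodgeType B'.dim B'.X (2 * 3) 3 3 w ∧ w ∈ weilClassesOf B' ψ 3 d ∧
            w' = complexBetti.map g (2 * 3) w}) := by
  haveI : HodgeTensorFacts.{0, 0} := hodgeTensorFacts_holds
  obtain ⟨ψ⟩ := BettiUniverse.hodge_isPolarizable exists_isReal_hodgeModel_holds
    (AbelianVariety.isSmoothProjective_holds (A := A)) 1
  exact WeilRows.census_row9_generalWeil A φ d e a hW.d_pos hW.dim_eq hW.sq_eq ha ha0
    (hW.hasHodgeGroupSU_ksymm_of_hodgeLieC hE2 ψ (hSU ψ) e ha ha0)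

/-- **Row 9 with `h_K`, every member modulo `hSU`, on the whole ISOGENY CLASS** (L7 / L7b).
[cite: vanGeemen1994HodgeAV, Thm. 6.12 and Lemma 3.7] [cite: MoonenZarhin1999LowDim, §5 (5.1)] -/
theorem census_row9_ksymm_ofLie_of_isIsogenous {A' : AbelianVariety ℂ} (hW : IsWeilType A φ 3 d)
    (hE2 : Module.finrank ℚ A.endAlgebra = 2)
    (hSU : haveI : HodgeTensorFacts.{0, 0} := hodgeTensorFacts_holds
      ∀ (ψ : (BettiUniverse.hodge exists_isReal_hodgeModel_holds (AbelianVariety.isSmoothProjective_holds (A := A)) 1).Polarization)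
        (Y : Module.End ℂ (ℂ ⊗[ℚ] bettiCohomology A.X 1))
        (hYφ : Y * ((bettiCohomology.map φ.hom.hom.hom 1).hom).baseChange ℂ =
          ((bettiCohomology.map φ.hom.hom.hom 1).hom).baseChange ℂ * Y),
        (∀ x y, ψ.form.baseChange ℂ (Y x) y + ψ.form.baseChange ℂ x (Y y) = 0) →
        LinearMap.trace ℂ _ (Y.restrict fun x (hx : x ∈ Module.End.eigenspace
            (((bettiCohomology.map φ.hom.hom.hom 1).hom).baseChange ℂ) (Complex.I * (Real.sqrt d : ℂ))) =>
          UnitaryTheta.apply_mem_eigenspace_of_commute hYφ hx) = 0 →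
        Y ∈ (BettiUniverse.hodge exists_isReal_hodgeModel_holds (AbelianVariety.isSmoothProjective_holds (A := A)) 1).hodgeLieC)
    (ha : IsRationalClass a) (ha0 : a ≠ 0) (hA'A : IsIsogenous A' A) :
    (A'.dim = 6 ∧ ¬ (IsOfCMType A' ∨ ProdCMCell IsQuarticFieldTypeIVFourfold (fun Z ↦ Z.dim = 2) A')) ∧
    (∀ c : complexBetti A'.X (2 * 2), IsRationalClass c → IsOfHodgeType A'.dim A'.X (2 * 2) 2 2 c →
      c ∈ divisorClassesSpan A'.X A'.dim 2 ⊔ Submodule.span ℂ {w' : complexBetti A'.X (2 * 2) |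
        ∃ (C : AbelianVariety ℂ) (g : A'.X ⟶ C.X) (w : complexBetti C.X (2 * 2)), C.dim < A'.dim ∧
          IsRationalClass w ∧ IsOfHodgeType C.dim C.X (2 * 2) 2 2 w ∧ w' = complexBetti.map g (2 * 2) w}) ∧
    (∀ c : complexBetti A'.X (2 * 3), IsRationalClass c → IsOfHodgeType A'.dim A'.X (2 * 3) 3 3 c →
      c ∈ divisorClassesSpan A'.X A'.dim 3 ⊔ Submodule.span ℂ {w' : complexBetti A'.X (2 * 3) |
          ∃ (a : complexBetti A'.X (2 * 2)) (b : complexBetti A'.X (2 * 1)),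
            IsRationalClass a ∧ IsOfHodgeType A'.dim A'.X (2 * 2) 2 2 a ∧ IsRationalClass b ∧
            IsOfHodgeType A'.dim A'.X (2 * 1) 1 1 b ∧ w' = cupProduct (two_mul_add_two_mul 2 1) a b} ⊔
        Submodule.span ℂ {w' : complexBetti A'.X (2 * 3) |
          ∃ (C : AbelianVariety ℂ) (g : A'.X ⟶ C.X) (w : complexBetti C.X (2 * 3)), C.dim < A'.dim ∧
            IsRationalClass w ∧ IsOfHodgeType C.dim C.X (2 * 3) 3 3 w ∧ w' = complexBetti.map g (2 * 3) w} ⊔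
        Submodule.span ℂ {w' : complexBetti A'.X (2 * 3) |
          ∃ (B' : AbelianVariety ℂ) (g : A'.X ⟶ B'.X) (d : ℕ) (ψ : B' ⟶ B') (w : complexBetti B'.X (2 * 3)),
            B'.dim = 6 ∧ 0 < d ∧ ψ ≫ ψ = -(d • 𝟙 B') ∧ IsRationalClass w ∧
            IsOfHodgeType B'.dim B'.X (2 * 3) 3 3 w ∧ w ∈ weilClassesOf B' ψ 3 d ∧
            w' = complexBetti.map g (2 * 3) w}) := by
  obtain ⟨hdom, h2, h3⟩ := census_row9_ksymm_ofLie A φ d e a hW hE2 hSU ha ha0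
  exact ⟨(offResidueSix_iff_of_isIsogenous hA'A).mpr hdom, (codimTwoCensusAt_iff_of_isIsogenous hA'A).mpr h2,
    (codimThreeCensusAt_iff_of_isIsogenous hA'A).mpr h3⟩

/-! ## §2 HC for row 9 from the named residues, modulo the Lie hypothesis -/

/-- **HC for every `End⁰ = K` Weil-type sixfold from the ladder item `WeilSixfolds`, MODULO `hSU`** — L12's
`hodgeConjectureFor_generalWeilSixfold_of_weilSixfolds` re-keyed (`HasHodgeGroupSU h_K ⟸ hSU`, B5a §6). `WeilSixfolds`
(stmt-HodgeConjecture-2524) and `hSU` displayed, not asserted. [cite: vanGeemen1994HodgeAV, 2.4, Thm. 4.11 and Thm. 6.12]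
[cite: MoonenZarhin1999LowDim, Thm. 0.2] -/
theorem hodgeConjectureFor_row9_ksymm_ofLie_of_weilSixfolds (hW₆ : Theses.SevenfoldWeilCensus.WeilSixfolds)
    (hW : IsWeilType A φ 3 d) (hE2 : Module.finrank ℚ A.endAlgebra = 2)
    (hSU : haveI : HodgeTensorFacts.{0, 0} := hodgeTensorFacts_holds
      ∀ (ψ : (BettiUniverse.hodge exists_isReal_hodgeModel_holds (AbelianVariety.isSmoothProjective_holds (A := A)) 1).Polarization)
        (Y : Module.End ℂ (ℂ ⊗[ℚ] bettiCohomology A.X 1))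
        (hYφ : Y * ((bettiCohomology.map φ.hom.hom.hom 1).hom).baseChange ℂ =
          ((bettiCohomology.map φ.hom.hom.hom 1).hom).baseChange ℂ * Y),
        (∀ x y, ψ.form.baseChange ℂ (Y x) y + ψ.form.baseChange ℂ x (Y y) = 0) →
        LinearMap.trace ℂ _ (Y.restrict fun x (hx : x ∈ Module.End.eigenspace
            (((bettiCohomology.map φ.hom.hom.hom 1).hom).baseChange ℂ) (Complex.I * (Real.sqrt d : ℂ))) =>
          UnitaryTheta.apply_mem_eigenspace_of_commute hYφ hx) = 0 →
        Y ∈ (BettiUniverse.hodge exists_isReal_hodgeModel_holds (AbelianVariety.isSmoothProjective_holds (A := A)) 1).hodgeLieC)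
    (ha : IsRationalClass a) (ha0 : a ≠ 0) : HodgeConjectureFor A.dim A.X := by
  haveI : HodgeTensorFacts.{0, 0} := hodgeTensorFacts_holds
  obtain ⟨ψ⟩ := BettiUniverse.hodge_isPolarizable exists_isReal_hodgeModel_holds
    (AbelianVariety.isSmoothProjective_holds (A := A)) 1
  exact WeilRows.hodgeConjectureFor_generalWeilSixfold_of_weilSixfolds A φ d e a hW₆ hW.d_pos hW.dim_eq hW.sq_eq ha ha0
    (hW.hasHodgeGroupSU_ksymm_of_hodgeLieC hE2 ψ (hSU ψ) e ha ha0)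

/-- **HC for every `End⁰ = K` Weil-type sixfold from the NAMED RESIDUES {Markman₆, R-W6}, MODULO `hSU`** — L12's
`hodgeConjectureFor_generalWeilSixfold_of_markman₆_nonsplit` re-keyed. Markman₆ (preprint, UNREFEREED), R-W6 (OPEN) and `hSU`
are displayed, not asserted. [cite: Markman2025SecantWeil, Thm. 1.5.1 (preprint, unrefereed)]
[claim: Markman2025SurveySecant, status: under-review] [cite: vanGeemen1994HodgeAV, Thm. 6.12] [cite: MoonenZarhin1999LowDim, Thm. 0.2] -/
theorem hodgeConjectureFor_row9_ksymm_ofLie_of_markman₆_nonsplit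
    (hMark₆ : Markman2025_weilClasses_algebraic_hyperbolicSixfold) (hRW6 : WeilTypeLadder.NonsplitSixfolds)
    (hW : IsWeilType A φ 3 d) (hE2 : Module.finrank ℚ A.endAlgebra = 2)
    (hSU : haveI : HodgeTensorFacts.{0, 0} := hodgeTensorFacts_holds
      ∀ (ψ : (BettiUniverse.hodge exists_isReal_hodgeModel_holds (AbelianVariety.isSmoothProjective_holds (A := A)) 1).Polarization)
        (Y : Module.End ℂ (ℂ ⊗[ℚ] bettiCohomology A.X 1))
        (hYφ : Y * ((bettiCohomology.map φ.hom.hom.hom 1).hom).baseChange ℂ =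
          ((bettiCohomology.map φ.hom.hom.hom 1).hom).baseChange ℂ * Y),
        (∀ x y, ψ.form.baseChange ℂ (Y x) y + ψ.form.baseChange ℂ x (Y y) = 0) →
        LinearMap.trace ℂ _ (Y.restrict fun x (hx : x ∈ Module.End.eigenspace
            (((bettiCohomology.map φ.hom.hom.hom 1).hom).baseChange ℂ) (Complex.I * (Real.sqrt d : ℂ))) =>
          UnitaryTheta.apply_mem_eigenspace_of_commute hYφ hx) = 0 →
        Y ∈ (BettiUniverse.hodge exists_isReal_hodgeModel_holds (AbelianVariety.isSmoothProjective_holds (A := A)) 1).hodgeLieC)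
    (ha : IsRationalClass a) (ha0 : a ≠ 0) : HodgeConjectureFor A.dim A.X :=
  hodgeConjectureFor_row9_ksymm_ofLie_of_weilSixfolds A φ d e a
    (WeilTypeLadder.weilSixfolds_of_nonsplitSixfolds_of_floor hMark₆ hRW6) hW hE2 hSU ha ha0

/-- **… and on the whole isogeny class** (van Geemen Lemma 3.7 = `HodgeConjectureFor.of_isIsogenous`).
[cite: vanGeemen1994HodgeAV, Lemma 3.7 and Thm. 6.12] [cite: Markman2025SecantWeil, Thm. 1.5.1 (preprint, unrefereed)] -/
theorem hodgeConjectureFor_of_isIsogenous_row9_ksymm_ofLie_of_markman₆_nonsplit {A' : AbelianVariety ℂ}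
    (hMark₆ : Markman2025_weilClasses_algebraic_hyperbolicSixfold) (hRW6 : WeilTypeLadder.NonsplitSixfolds)
    (hW : IsWeilType A φ 3 d) (hE2 : Module.finrank ℚ A.endAlgebra = 2)
    (hSU : haveI : HodgeTensorFacts.{0, 0} := hodgeTensorFacts_holds
      ∀ (ψ : (BettiUniverse.hodge exists_isReal_hodgeModel_holds (AbelianVariety.isSmoothProjective_holds (A := A)) 1).Polarization)
        (Y : Module.End ℂ (ℂ ⊗[ℚ] bettiCohomology A.X 1))
        (hYφ : Y * ((bettiCohomology.map φ.hom.hom.hom 1).hom).baseChange ℂ =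
          ((bettiCohomology.map φ.hom.hom.hom 1).hom).baseChange ℂ * Y),
        (∀ x y, ψ.form.baseChange ℂ (Y x) y + ψ.form.baseChange ℂ x (Y y) = 0) →
        LinearMap.trace ℂ _ (Y.restrict fun x (hx : x ∈ Module.End.eigenspace
            (((bettiCohomology.map φ.hom.hom.hom 1).hom).baseChange ℂ) (Complex.I * (Real.sqrt d : ℂ))) =>
          UnitaryTheta.apply_mem_eigenspace_of_commute hYφ hx) = 0 →
        Y ∈ (BettiUniverse.hodge exists_isReal_hodgeModel_holds (AbelianVariety.isSmoothProjective_holds (A := A)) 1).hodgeLieC)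
    (ha : IsRationalClass a) (ha0 : a ≠ 0) (hA'A : IsIsogenous A' A) : HodgeConjectureFor A'.dim A'.X :=
  HodgeConjectureFor.of_isIsogenous hA'A
    (hodgeConjectureFor_row9_ksymm_ofLie_of_markman₆_nonsplit A φ d e a hMark₆ hRW6 hW hE2 hSU ha ha0)

end Summit.HodgeConjecture.HodgeConjecture.TableX.WeilLieRows
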